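import Mathlib.GroupTheory.Commensurable
import Mathlib.GroupTheory.Index
import Mathlib.Data.Rat.Cast.Order
import Mathlib.Tactic.FieldSimp
import Mathlib.Tactic.Ring
import HarnessLib

/-!
# The generalized index of commensurable subgroups: `[A : B]_gen = [B : A ∩ B] / [A : A ∩ B]`

Topic `GroupTheory`.  KERNEL ONLY: theorems over Mathlib's `Subgroup.relIndex` ∕ `Subgroup.Commensurable` (no definition — the generalized
index is written out as the rational number `(A.relIndex B : ℚ) / (B.relIndex A : ℚ)`, recall `A.relIndex B = [B : A ⊓ B]`).

For COMMENSURABLE subgroups `A, B` of a group (`[A : A ∩ B] < ∞`, `[B : A ∩ B] < ∞`) the generalized index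
`q(A, B) := [B : A ∩ B] / [A : A ∩ B] ∈ ℚ_{>0}` ([ShimuraIATAF1971, §3.1 before Prop. 3.1]: for a Haar measure `μ` on a group in which `A, B` are
open compact, `q(A, B) = μ(B)/μ(A)`) satisfies: `q(A, A) = 1`, `q(A, B) · q(B, A) = 1`, the COCYCLE ∕ transitivity rule `q(A, C) = q(A, B) · q(B, C)`
(compute all three through a common finite-index subgroup `D = A ∩ B ∩ C`: `q(X, Y) = [Y : D]/[X : D]`), `q(A, B) = 1/[A : B]` for `B ≤ A`, and
invariance under group automorphisms (conjugation).  CONSUMER: the hodgecm-mathlib cell's level-form assembly (b6) for binder `h413` (A-p10's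
`SPEC-b6-LevelFormAssembly.md`): the «Haar part» of the class weights is `ν(K) := q(K_f(3), K)` on the open compact subgroups of `U(V)(𝔸_f)`, with
`ν(K') = ν(K)/[K : K']` (`relIndexRatio_of_le` + transitivity) and `ν(gKg⁻¹) = q(K₃, gK₃g⁻¹) · ν(K)` (conjugation invariance + transitivity), the
factor `q(K₃, gK₃g⁻¹)` being `1` for `g ∈ K₃`.

## References
* [ShimuraIATAF1971] G. Shimura, *Introduction to the Arithmetic Theory of Automorphic Functions* (1971), §3.1 (commensurable subgroups; the
  measure `μ(Γ α Γ)` and degrees of double cosets), Prop. 3.1.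
* Mathlib: `Mathlib/GroupTheory/Index.lean` (`Subgroup.relIndex`, `relIndex_mul_relIndex`, `inf_relIndex_right`, `relIndex_inf_ne_zero`),
  `Mathlib/GroupTheory/Commensurable.lean`.
-/

namespace Literature.GroupTheory

open Subgroup

variable {G : Type*} [Group G]

/-! ## §1 Computing the ratio through a common subgroup of finite index -/

/-- If `D ≤ A ⊓ B` has finite index in `A`, then `[B : A ⊓ B] / [A : A ⊓ B] = [B : D] / [A : D]` — both sides are the ratio of the
«sizes» of `B` and `A` measured against `D`. [cite: ShimuraIATAF1971, §3.1] -/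
theorem relIndexRatio_eq_of_le (A B D : Subgroup G) (hDA : D ≤ A) (hDB : D ≤ B) (hA : D.relIndex A ≠ 0) :
    (A.relIndex B : ℚ) / (B.relIndex A : ℚ) = (D.relIndex B : ℚ) / (D.relIndex A : ℚ) := by
  -- `[B : D] = [B : A ⊓ B] · [A ⊓ B : D]`, `[A : D] = [A : A ⊓ B] · [A ⊓ B : D]`
  have hDAB : D ≤ A ⊓ B := le_inf hDA hDB
  have eB : D.relIndex (A ⊓ B) * (A ⊓ B).relIndex B = D.relIndex B := relIndex_mul_relIndex D (A ⊓ B) B hDAB inf_le_right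
  have eA : D.relIndex (A ⊓ B) * (A ⊓ B).relIndex A = D.relIndex A := relIndex_mul_relIndex D (A ⊓ B) A hDAB inf_le_left
  rw [inf_relIndex_right] at eB
  rw [inf_relIndex_left] at eA
  have hm : (D.relIndex (A ⊓ B) : ℚ) ≠ 0 := by
    have : D.relIndex (A ⊓ B) ≠ 0 := fun h => hA (by rw [← eA, h, zero_mul])
    exact_mod_cast this
  rw [← eB, ← eA, Nat.cast_mul, Nat.cast_mul, mul_div_mul_left _ _ hm]

/-! ## §2 The generalized index of commensurable subgroups -/

/-- `q(A, A) = 1`. [cite: ShimuraIATAF1971, §3.1] -/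
theorem relIndexRatio_self (A : Subgroup G) : (A.relIndex A : ℚ) / (A.relIndex A : ℚ) = 1 := by
  rw [relIndex_self, Nat.cast_one, div_one]

/-- `q(A, B) · q(B, A) = 1` for commensurable `A, B`. [cite: ShimuraIATAF1971, §3.1] -/
theorem relIndexRatio_mul_symm {A B : Subgroup G} (h : Commensurable A B) :
    (A.relIndex B : ℚ) / (B.relIndex A : ℚ) * ((B.relIndex A : ℚ) / (A.relIndex B : ℚ)) = 1 := by
  have h1 : (A.relIndex B : ℚ) ≠ 0 := by exact_mod_cast h.1
  have h2 : (B.relIndex A : ℚ) ≠ 0 := by exact_mod_cast h.2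
  field_simp

/-- `q(A, B)` is positive for commensurable `A, B`. [cite: ShimuraIATAF1971, §3.1] -/
theorem relIndexRatio_pos {A B : Subgroup G} (h : Commensurable A B) : 0 < (A.relIndex B : ℚ) / (B.relIndex A : ℚ) :=
  div_pos (by exact_mod_cast Nat.pos_of_ne_zero h.1) (by exact_mod_cast Nat.pos_of_ne_zero h.2)

/-- **Transitivity (the cocycle rule) of the generalized index**: `q(A, C) = q(A, B) · q(B, C)` for pairwise commensurable `A, B, C` — all three
ratios are computed against the common finite-index subgroup `D = A ⊓ B ⊓ C`. [cite: ShimuraIATAF1971, §3.1, Prop. 3.1] -/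
theorem relIndexRatio_trans {A B C : Subgroup G} (hAB : Commensurable A B) (hBC : Commensurable B C) (hAC : Commensurable A C) :
    (A.relIndex C : ℚ) / (C.relIndex A : ℚ) = (A.relIndex B : ℚ) / (B.relIndex A : ℚ) * ((B.relIndex C : ℚ) / (C.relIndex B : ℚ)) := by
  -- the common subgroup and its finite indices
  set D : Subgroup G := A ⊓ B ⊓ C with hD
  have hDA : D ≤ A := (inf_le_left.trans inf_le_left)
  have hDB : D ≤ B := (inf_le_left.trans inf_le_right)
  have hDC : D ≤ C := inf_le_right
  -- `[X : D] ≠ 0` for `X = A, B, C` (commensurability)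
  have hA : D.relIndex A ≠ 0 := by
    rw [hD, inf_assoc, inf_relIndex_left]
    exact relIndex_inf_ne_zero hAB.2 hAC.2
  have hB : D.relIndex B ≠ 0 := by
    have e : D = B ⊓ (A ⊓ C) := by
      rw [hD]; apply le_antisymm
      · exact le_inf hDB (le_inf hDA hDC)
      · exact le_inf (le_inf (inf_le_right.trans inf_le_left) inf_le_left) (inf_le_right.trans inf_le_right)
    rw [e, inf_relIndex_left]
    exact relIndex_inf_ne_zero hAB.1 hBC.2
  rw [relIndexRatio_eq_of_le A C D hDA hDC hA, relIndexRatio_eq_of_le A B D hDA hDB hA, relIndexRatio_eq_of_le B C D hDB hDC hB]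
  have hB' : (D.relIndex B : ℚ) ≠ 0 := by exact_mod_cast hB
  have hA' : (D.relIndex A : ℚ) ≠ 0 := by exact_mod_cast hA
  field_simp

/-- For `B ≤ A` of finite index, `q(A, B) = 1/[A : B]` — a subgroup of index `n` has `1/n` of the mass. [cite: ShimuraIATAF1971, §3.1] -/
theorem relIndexRatio_of_le {A B : Subgroup G} (hBA : B ≤ A) :
    (A.relIndex B : ℚ) / (B.relIndex A : ℚ) = 1 / (B.relIndex A : ℚ) := by
  rw [relIndex_eq_one.mpr hBA, Nat.cast_one]

/-- **Invariance under injective homomorphisms** (in particular under conjugation `x ↦ g x g⁻¹`): `q(f A, f B) = q(A, B)`.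
[cite: ShimuraIATAF1971, §3.1] -/
theorem relIndexRatio_map_of_injective {G' : Type*} [Group G'] {f : G →* G'} (hf : Function.Injective f) (A B : Subgroup G) :
    ((A.map f).relIndex (B.map f) : ℚ) / ((B.map f).relIndex (A.map f) : ℚ) = (A.relIndex B : ℚ) / (B.relIndex A : ℚ) := by
  rw [relIndex_map_map_of_injective A B hf, relIndex_map_map_of_injective B A hf]

/-- Conjugation invariance: `q(gAg⁻¹, gBg⁻¹) = q(A, B)`. [cite: ShimuraIATAF1971, §3.1] -/
theorem relIndexRatio_conj (g : G) (A B : Subgroup G) :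
    ((A.map (MulAut.conj g).toMonoidHom).relIndex (B.map (MulAut.conj g).toMonoidHom) : ℚ) /
        ((B.map (MulAut.conj g).toMonoidHom).relIndex (A.map (MulAut.conj g).toMonoidHom) : ℚ) =
      (A.relIndex B : ℚ) / (B.relIndex A : ℚ) :=
  relIndexRatio_map_of_injective (MulAut.conj g).injective A B

/-! ## §3 The «Haar part» of the class weights: mass of an open compact relative to a reference one -/

/-- **Refinement rule** `ν(K') · [K : K'] = ν(K)` for `K' ≤ K` of finite index, `ν(K) := q(K₀, K)` the mass of `K` relative to a reference `K₀`
commensurable with both (for open compact subgroups of a locally compact group this is `μ(K')[K : K'] = μ(K)`). [cite: ShimuraIATAF1971, §3.1, Prop. 3.1] -/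
theorem relIndexRatio_refine {K₀ K K' : Subgroup G} (hK' : K' ≤ K) (h0K : Commensurable K₀ K) (h0K' : Commensurable K₀ K')
    (hKK' : Commensurable K K') :
    (K₀.relIndex K' : ℚ) / (K'.relIndex K₀ : ℚ) * (K'.relIndex K : ℚ) = (K₀.relIndex K : ℚ) / (K.relIndex K₀ : ℚ) := by
  rw [relIndexRatio_trans h0K hKK' h0K', relIndexRatio_of_le hK']
  have h : (K'.relIndex K : ℚ) ≠ 0 := by exact_mod_cast hKK'.2
  field_simp

/-- **Translation rule** `ν(gKg⁻¹) = χ(g) · ν(K)` with `χ(g) := q(K₀, gK₀g⁻¹)` (the modular character read on the reference subgroup), for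
`ν(K) := q(K₀, K)`: transitivity through `gK₀g⁻¹` and conjugation invariance `q(gK₀g⁻¹, gKg⁻¹) = q(K₀, K)`.
[cite: ShimuraIATAF1971, §3.1, Prop. 3.1] -/
theorem relIndexRatio_conj_eq_mul (g : G) {K₀ K : Subgroup G} (h0K : Commensurable K₀ K)
    (h0g0 : Commensurable K₀ (K₀.map (MulAut.conj g).toMonoidHom)) (h0gK : Commensurable K₀ (K.map (MulAut.conj g).toMonoidHom)) :
    (K₀.relIndex (K.map (MulAut.conj g).toMonoidHom) : ℚ) / ((K.map (MulAut.conj g).toMonoidHom).relIndex K₀ : ℚ) =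
      (K₀.relIndex (K₀.map (MulAut.conj g).toMonoidHom) : ℚ) / ((K₀.map (MulAut.conj g).toMonoidHom).relIndex K₀ : ℚ) *
        ((K₀.relIndex K : ℚ) / (K.relIndex K₀ : ℚ)) := by
  have hg : Commensurable (K₀.map (MulAut.conj g).toMonoidHom) (K.map (MulAut.conj g).toMonoidHom) := by
    constructor
    · rw [relIndex_map_map_of_injective K₀ K (MulAut.conj g).injective]; exact h0K.1
    · rw [relIndex_map_map_of_injective K K₀ (MulAut.conj g).injective]; exact h0K.2
  rw [relIndexRatio_trans h0g0 hg h0gK, relIndexRatio_conj g K₀ K]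

/-- The modular factor is trivial on the reference subgroup: `χ(k) = q(K₀, kK₀k⁻¹) = 1` for `k ∈ K₀` (then `kK₀k⁻¹ = K₀`).
[cite: ShimuraIATAF1971, §3.1] -/
theorem relIndexRatio_conj_self_of_mem {K₀ : Subgroup G} {k : G} (hk : k ∈ K₀) :
    (K₀.relIndex (K₀.map (MulAut.conj k).toMonoidHom) : ℚ) / ((K₀.map (MulAut.conj k).toMonoidHom).relIndex K₀ : ℚ) = 1 := by
  have e : K₀.map (MulAut.conj k).toMonoidHom = K₀ := by
    ext x
    constructor
    · rintro ⟨y, hy, rfl⟩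
      exact K₀.mul_mem (K₀.mul_mem hk hy) (K₀.inv_mem hk)
    · intro hx
      refine ⟨k⁻¹ * x * k, K₀.mul_mem (K₀.mul_mem (K₀.inv_mem hk) hx) hk, ?_⟩
      simp [MulAut.conj_apply, mul_assoc]
  rw [e, relIndexRatio_self]

end Literature.GroupTheory
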